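import Summits.BirchSwinnertonDyer.BirchSwinnertonDyer.Theorems.ResidualThetaTransportAtTwoKatoZetaDefs
import Summits.BirchSwinnertonDyer.BirchSwinnertonDyer.Theorems.ResidualThetaTransportAtTwoResidualSignedLambdaLowerCMAtTwoZetaQuotientComposite
import HarnessLib

/-!
# Sketch (stub-ideation k = 4, gen 31, technique «assume the opposite») — crux `ResidualThetaCountLowerPureAtTwo`
# (stmt-BirchSwinnertonDyer-26074), stub `stub_cmLambdaLower` (closed mod print since v8), event = LEAD's PREPARED v9 bytes

GAUGE CENSUS of the valued class `OnePairPins.KatoValuedClass` (the print-side content of KZ_g): v9 keeps the ∀-form child B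
`stub_kzgChildB` registered while child A is now ported by name.  ASSUME THE OPPOSITE of that ∀-text: then some valued class
`(z, c′, w, q, μ̃)` at a frame has LARGER slack `λ(𝐇¹/Λz) − λ(Λ/μ̃)` than Kato's.  Every deformation of a valued class at a fixed frame
is generated by (G1) constant exchange `(q, C u·μ̃₀) ↦ (q·u, μ̃₀)`, (G1′) `ϖ`-powers (λ is μ-blind), (G2) Λ-twist
`(z, w, μ̃) ↦ (h•z, h·w, h·μ̃)`, (G4) torsion translate (vacuous: `𝐇¹` is torsion-free), (G5) coordinate gauge
`(c′, w, q) ↦ (u·c′, M_u⁻¹·w, u⁻¹·q)`; each is slack-neutral, and the only slack-moving deformation (G3: `μ̃` alone) is excluded because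
(BKρ) pins the even-character sums of `w` (the functions `b ↦ σ_b(x)`, `x ∈ ℚ₂(ζ_{2^{m+2}})⁺ = ℚ_{2,m}`, span the even functions on
`(ℤ/2^{m+2})ˣ`).  VERDICT: no counterexample modulo print; the ∀-text ⟺ «Kato125AB» ∧ (B≡).

CONTENTS. §1 the census LOGIC in the kernel (abstract: ∀-from-∃ under a slack invariant; the slack arithmetic of commensurable pairs).
§2 over the tree's definitions, PROVED: (G1) `gaugeG1` (constant exchange maps valued classes to valued classes — `coeff_C_mul` +
`tsum_mul_left` on the (VALρ)/(TRIVρ) right-hand sides), (MB) `muBlind` (`λ(Λ/(C c·μ)) = λ(Λ/μ)`, from the landed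
`CharIdealLambda.ZetaQuotientComposite.finrank_baseChange_quotient_eq_of_smul_le`), (G5₀) `coordNondeg_mul_left` (the (ND) clause is
gauge-stable), the unit sub-case of (G2) on both sides of the slack (`lamO_quot_span_unit_mul_eq`, `lamO_zetaQuot_unit_smul_eq` — the
(M)-falsifier pair `(z, (1+X)•z)` run in kernel); TYPED SIGNATURES (`def … : Prop`, nothing asserted): the transports (G2), (G5) and the
census closure (B≡) `SlackInvarianceStatement` — helper-lemma signatures for the plans of the idea card `Ideas/stub-cmlambdalower-k4-g31.md`.
THEOREMS + Prop-valued defs only; no `sorry`, no axiom, no instance.  BSD is NOT proved by anything here; items 26074 / 22608 stay OPEN.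
-/

set_option autoImplicit false
set_option linter.dupNamespace false
set_option backward.isDefEq.respectTransparency false

noncomputable section

open scoped Classical NumberField TensorProduct

namespace Summit.BirchSwinnertonDyer.BirchSwinnertonDyer.Cruxes.ResidualThetaCountLowerPureAtTwo.SideaK4G31

open Literature.NumberTheory.EllipticCurves Literature.NumberTheory.EllipticCurves.GreenbergSelmer
open Literature.NumberTheory.GaloisRepresentations NumberField IsDedekindDomain Field
open GreenbergVatsal2000 Kobayashi2003 Rat.HeightOneSpectrum PowerSeries
open Literature.NumberTheory.EllipticCurves.FormalGroupChart
open Summit.BirchSwinnertonDyer.Rank1Residual.Additive Summit.BirchSwinnertonDyer.Rank1Residual.Additive.PadicCyclotomicTower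
  Summit.BirchSwinnertonDyer.Rank1Residual.Additive.BallEval
open Summit.BirchSwinnertonDyer.BirchSwinnertonDyer.Theorems.SignedKatoOffTwo
  Summit.BirchSwinnertonDyer.BirchSwinnertonDyer.Theorems.SignedKatoOffTwo.LocalTwo
open Summit.BirchSwinnertonDyer.BirchSwinnertonDyer.Theorems.OnePair

/-! ## §1 Census logic (kernel) -/

section CensusLogic

variable {α : Type*}

/-- **(L1) ∀ from ∃ under an invariant.** If any two valued objects are related (`R`), `R` transports the conclusion `P`, and ONE
valued object satisfies `P`, then EVERY valued object does — the logical skeleton of closing the registered ∀-form child B from the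
print ∃-form «Kato125AB» through the slack identity (B≡) (ROAD S). -/
theorem forall_of_exists_of_invariant (V P : α → Prop) (R : α → α → Prop)
    (hR : ∀ a b, V a → V b → R a b) (hinv : ∀ a b, R a b → P a → P b) (hex : ∃ a, V a ∧ P a) :
    ∀ b, V b → P b := by
  intro b hb
  obtain ⟨a, ha, hPa⟩ := hex
  exact hinv a b (hR a b ha hb) hPa

/-- **(L1′) the contrapositive the obstruction hunt uses:** a valued object violating `P` forces, for every valued object satisfying
`P`, a related pair along which `P` is NOT transported — i.e. a slack-RAISING deformation. -/
theorem exists_nonInvariant_pair_of_counterexample (V P : α → Prop) (R : α → α → Prop)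
    (hR : ∀ a b, V a → V b → R a b) {a b : α} (ha : V a) (hPa : P a) (hb : V b) (hPb : ¬ P b) :
    ∃ x y, R x y ∧ P x ∧ ¬ P y :=
  ⟨a, b, hR a b ha hb, hPa, hPb⟩

/-- **(L2) slack arithmetic of a commensurable pair.** With `λz + λ(s₁) = λz′ + λ(s₂)` (commensurability `s₁•z = s₂•z′` read in λ)
and `λμ + λ(s₁) = λμ′ + λ(s₂)` (the multiplier relation read in λ), the slack identity (B≡) `λz + λμ′ = λz′ + λμ` follows. -/
theorem slack_eq_of_commensurable {lz lz' lm lm' l₁ l₂ : ℕ} (hz : lz + l₁ = lz' + l₂) (hm : lm + l₁ = lm' + l₂) :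
    lz + lm' = lz' + lm := by
  omega

/-- **(L3) (ii_λ) is transported along (B≡):** `λz ≤ λS + λμ` and `λz + λμ′ = λz′ + λμ` give `λz′ ≤ λS + λμ′`. -/
theorem iiLam_of_slack_eq {lz lz' lm lm' lS : ℕ} (h : lz ≤ lS + lm) (hs : lz + lm' = lz' + lm) : lz' ≤ lS + lm' := by
  omega

/-- **(L4) every generator slack-neutral ⇒ no slack-raising word:** if each of finitely many composable steps preserves the slack
(`s (k+1) = s k`), the slack after `N` steps equals the initial one — the census conclusion "no word in (G1)–(G5) raises the slack". -/
theorem slack_const_of_steps (s : ℕ → ℤ) (hstep : ∀ k, s (k + 1) = s k) (N : ℕ) : s N = s 0 := by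
  induction N with
  | zero => rfl
  | succ k ih => rw [hstep k, ih]

end CensusLogic

/-! ## §2 The gauge generators over the tree's `KatoValuedClass` -/

section Gauge

variable {S : Set (PadicAlgCl 2)} {W : WeierstrassCurve ℚ} [W.IsElliptic] {κ : ZpExtension ℚ 2} {γ : absoluteGaloisGroup ℚ}
  {S₀ : Finset (HeightOneSpectrum (𝓞 ℚ))} {n : ℕ} {ρ : FramedGaloisRep ℚ ↥(padicCoeffIntegers S) 2}
  {Θ : ∀ v : HeightOneSpectrum (𝓞 ℚ), ((2 : ℕ) : 𝓞 ℚ) ∈ v.asIdeal → (Cofree ρ ↥(padicCoeffField S) ≃+ (Fin n → ↥(W.geomPrimaryTorsion 2)))}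
  {hΘ : ∀ v hv (δ : absoluteGaloisGroup (v.adicCompletion ℚ)) m i,
    Θ v hv (resGalOfEmb (closureEmb (K := ℚ) (v.adicCompletion ℚ)) δ • m) i = resGalOfEmb (closureEmb (K := ℚ) (v.adicCompletion ℚ)) δ • Θ v hv m i}
  {I : Kato2004.IwasawaH1DataCoeff (FramedGaloisRep.toGaloisRep ρ) 2 κ γ}
  {Sg : AddSubgroup (subgroupH1 κ.kerSubgroup (Cofree ρ ↥(padicCoeffField S)))} [Module ↥(padicCoeffIntegers S) ↥Sg]
  (π : OnePairPins S W κ γ S₀ n ρ Θ hΘ I Sg)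

/-- **(G5₀) the (ND) clause is stable under the coordinate gauge `c′ ↦ u·c′` (`u ≠ 0` in the domain `𝒪`):** the functional
`a ↦ (t₀(u c′_i a))_i` is `a ↦ (t₀(c′_i (u a)))_i`, injective as the composite of `a ↦ u a` and the (ND) functional of `c′`. PROVED. -/
theorem coordNondeg_mul_left {c' : Fin n → ↥(padicCoeffIntegers S)} (h : π.CoordNondeg c')
    {u : ↥(padicCoeffIntegers S)} (hu : u ≠ 0) : π.CoordNondeg (fun i => u * c' i) := by
  intro a b hab
  apply mul_right_injective₀ hu
  apply h
  funext i
  have hi : π.t₀ (u * c' i * a) = π.t₀ (u * c' i * b) := congr_fun hab i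
  show π.t₀ (c' i * (u * a)) = π.t₀ (c' i * (u * b))
  rw [mul_left_comm (c' i) u a, mul_left_comm (c' i) u b, ← mul_assoc, ← mul_assoc]
  exact hi

/-- **(G1) constant exchange between the scalar `q` and the multiplier `μ̃` — the statement (PROVED below as `gaugeG1`).**
`(z, c′, w, q, C u·μ̃₀)` valued ⇒ `(z, c′, w, q·u, μ̃₀)` valued: (VALρ)/(TRIVρ) see only the product `q·μ̃(·)`, (BKρ)/(ND) do not see
`q, μ̃`; `λ(Λ/C u·μ̃₀) = λ(Λ/μ̃₀)` by (MB).  Proof route: `PowerSeries.coeff_C_mul`, `tsum_mul_left`, `map_mul`. -/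
def GaugeG1Statement [W.IsGloballyMinimal] {M : ℕ} [NeZero M] (g : CuspForm (CongruenceSubgroup.Gamma0 M) 2)
    (ι : ModularForms.coeffField g →+* PadicAlgCl 2) (Ω : ℂ) : Prop :=
  ∀ (Φ : AlgebraicClosure ℚ_[2] ≃ₐ[ℚ] AlgebraicClosure (π.v.adicCompletion ℚ))
    (τ : ∀ m : ℕ, ZMod (2 ^ m) → Field.absoluteGaloisGroup ℚ_[2])
    (z : I.H) (c' : Fin n → ↥(padicCoeffIntegers S)) (w : ℕ → Fin π.nb → PadicAlgCl 2) (q : PadicAlgCl 2)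
    (μt₀ : IwasawaAlgebraO S) (u : ↥(padicCoeffIntegers S)), u ≠ 0 →
    π.KatoValuedClass g ι Ω Φ τ z c' w q ((PowerSeries.C u : IwasawaAlgebraO S) * μt₀) →
    π.KatoValuedClass g ι Ω Φ τ z c' w (q * (u : PadicAlgCl 2)) μt₀

/-- **(G1) PROVED:** the constant exchange `(q, C u·μ̃₀) ↦ (q·u, μ̃₀)` maps valued classes to valued classes (the (VALρ)/(TRIVρ)
right-hand sides see only the product `q·μ̃(·)`; `u` leaves the `Λ_𝒪`-coefficients through `PowerSeries.coeff_C_mul` and the sum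
through `tsum_mul_left`). With (MB) this generator is slack-neutral. -/
theorem gaugeG1 [W.IsGloballyMinimal] {M : ℕ} [NeZero M] (g : CuspForm (CongruenceSubgroup.Gamma0 M) 2)
    (ι : ModularForms.coeffField g →+* PadicAlgCl 2) (Ω : ℂ) : GaugeG1Statement π g ι Ω := by
  intro Φ τ z c' w q μt₀ u hu h
  obtain ⟨hq, hμ, hND, hBK, hV, hT⟩ := h
  have hu' : (u : PadicAlgCl 2) ≠ 0 := by simpa using hu
  refine ⟨mul_ne_zero hq hu', right_ne_zero_of_mul hμ, hND, hBK, ?_, ?_⟩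
  · intro m ψ hψ hprim
    have hv := hV m ψ hψ hprim
    have hsum :
        (∑' k, algebraMap (PadicAlgCl 2) ℂ_[2]
            ((PowerSeries.coeff k ((PowerSeries.C u : IwasawaAlgebraO S) * μt₀) : ↥(padicCoeffIntegers S)) : PadicAlgCl 2) *
          (algebraMap (PadicAlgCl 2) ℂ_[2] (ψ (5 : ZMod (2 ^ (m + 2)))) - 1) ^ k) =
        algebraMap (PadicAlgCl 2) ℂ_[2] (u : PadicAlgCl 2) *
          ∑' k, algebraMap (PadicAlgCl 2) ℂ_[2] ((PowerSeries.coeff k μt₀ : ↥(padicCoeffIntegers S)) : PadicAlgCl 2) *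
            (algebraMap (PadicAlgCl 2) ℂ_[2] (ψ (5 : ZMod (2 ^ (m + 2)))) - 1) ^ k := by
      rw [← tsum_mul_left]
      refine tsum_congr fun k => ?_
      rw [PowerSeries.coeff_C_mul, Subring.coe_mul, map_mul, mul_assoc]
    rw [hv, hsum, map_mul]
    ring
  · intro k hk hk'
    rw [hT k hk hk', PowerSeries.coeff_C_mul, Subring.coe_mul]
    ring

/-- **(G5) coordinate gauge — TYPED SIGNATURE (helper H-G5; nothing asserted).** `(z, c′, w, q, μ̃)` valued and `u ≠ 0` in `𝒪` ⇒
`(z, u·c′, w′, u⁻¹·q, μ̃)` valued for some `w′` (namely `w′ = M_u⁻¹·w`, `M_u` = the `ℤ₂`-matrix of `y ↦ u y` in the dual families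
`bO, bO′`): (BKρ) is `t₀`-linear in `c′_i a`, and `Σ_j bO_j ⊗ (M_u⁻¹ w)_j = u⁻¹·Σ_j bO_j ⊗ w_j` with `u⁻¹ ∈ Frac 𝒪` OUTSIDE the Galois
sums of (VALρ)/(TRIVρ), so `q ↦ u⁻¹ q` and `μ̃` is UNCHANGED — the class-level content of "frame terms are constants" (T97). -/
def GaugeG5Statement [W.IsGloballyMinimal] {M : ℕ} [NeZero M] (g : CuspForm (CongruenceSubgroup.Gamma0 M) 2)
    (ι : ModularForms.coeffField g →+* PadicAlgCl 2) (Ω : ℂ) : Prop :=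
  ∀ (Φ : AlgebraicClosure ℚ_[2] ≃ₐ[ℚ] AlgebraicClosure (π.v.adicCompletion ℚ))
    (τ : ∀ m : ℕ, ZMod (2 ^ m) → Field.absoluteGaloisGroup ℚ_[2])
    (z : I.H) (c' : Fin n → ↥(padicCoeffIntegers S)) (w : ℕ → Fin π.nb → PadicAlgCl 2) (q : PadicAlgCl 2)
    (μt : IwasawaAlgebraO S) (u : ↥(padicCoeffIntegers S)), u ≠ 0 →
    π.KatoValuedClass g ι Ω Φ τ z c' w q μt →
    ∃ w' : ℕ → Fin π.nb → PadicAlgCl 2, π.KatoValuedClass g ι Ω Φ τ z (fun i => u * c' i) w' (q * (u : PadicAlgCl 2)⁻¹) μt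

/-- **(G2) Λ-twist — TYPED SIGNATURE (helper H-G2; nothing asserted).** `(z, c′, w, q, μ̃)` valued and `h ≠ 0` in `Λ_𝒪` ⇒
`(h•z, c′, w′, q, h·μ̃)` valued for some `w′` (namely the Galois-twisted `w′ = Σ_c h_c τ_c•w`): `proj_T_smul` / `proj_C_smul`
(`X ↦ conj_γ − 1`), the equivariance of the pinned layer pairing, and `IsCyclotomicVariable 2 γ` (`χ(γ) = ±5`, the sign invisible
on EVEN characters) turn `ψ(h) ` into `h(ψ(5) − 1)` with NO involution and NO change-of-generator unit.  Slack-neutral: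
`λ(𝐇¹/Λ·h z) = λ(𝐇¹/Λ z) + λ(Λ/h)` (k2-g33 H-STAB) and `λ(Λ/h μ̃) = λ(Λ/μ̃) + λ(Λ/h)`. -/
def GaugeG2Statement [W.IsGloballyMinimal] {M : ℕ} [NeZero M] (g : CuspForm (CongruenceSubgroup.Gamma0 M) 2)
    (ι : ModularForms.coeffField g →+* PadicAlgCl 2) (Ω : ℂ) : Prop :=
  ∀ (Φ : AlgebraicClosure ℚ_[2] ≃ₐ[ℚ] AlgebraicClosure (π.v.adicCompletion ℚ))
    (τ : ∀ m : ℕ, ZMod (2 ^ m) → Field.absoluteGaloisGroup ℚ_[2])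
    (z : I.H) (c' : Fin n → ↥(padicCoeffIntegers S)) (w : ℕ → Fin π.nb → PadicAlgCl 2) (q : PadicAlgCl 2)
    (μt h : IwasawaAlgebraO S), h ≠ 0 →
    π.KatoValuedClass g ι Ω Φ τ z c' w q μt →
    ∃ w' : ℕ → Fin π.nb → PadicAlgCl 2, π.KatoValuedClass g ι Ω Φ τ (h • z) c' w' q (h * μt)

/-- **(MB) μ-blindness of `λ_𝒪` on cyclic quotients — the statement (PROVED below as `muBlind`).** For `c ≠ 0` in `𝒪`:
`λ(Λ_𝒪/(C c·μ)) = λ(Λ_𝒪/(μ))` — `0 → Λ/(μ) → Λ/(C c·μ) → Λ/(C c) → 0` and `Frac 𝒪 ⊗_𝒪 Λ/(C c) = 0` (`c` is a unit of `Frac 𝒪`),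
`Frac 𝒪` flat over `𝒪`.  This is what makes (G1)/(G1′) slack-neutral. -/
def MuBlindStatement : Prop :=
  ∀ (μ : IwasawaAlgebraO S) (c : ↥(padicCoeffIntegers S)), c ≠ 0 → μ ≠ 0 →
    lamO S (IwasawaAlgebraO S ⧸ Ideal.span {(PowerSeries.C c : IwasawaAlgebraO S) * μ}) =
      lamO S (IwasawaAlgebraO S ⧸ Ideal.span {μ})

/-- **(MB) PROVED** from the landed «constant isogeny is λ-invisible»
(`CharIdealLambda.ZetaQuotientComposite.finrank_baseChange_quotient_eq_of_smul_le`, with `H := Λ_𝒪`, `N := (C c·μ) ≤ Z := (μ)`,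
`c • Z ≤ N`, `c` a unit of `Frac 𝒪`). So the generators (G1)/(G1′) are slack-neutral in the kernel. -/
theorem muBlind : MuBlindStatement (S := S) := by
  intro μ c hc _hμ
  rw [lamO_eq, lamO_eq]
  have hle : Ideal.span {(PowerSeries.C c : IwasawaAlgebraO S) * μ} ≤ Ideal.span {μ} := by
    rw [Ideal.span_singleton_le_iff_mem]
    exact Ideal.mul_mem_left _ _ (Ideal.mem_span_singleton_self μ)
  refine Summit.BirchSwinnertonDyer.BirchSwinnertonDyer.Theorems.CharIdealLambda.ZetaQuotientComposite.finrank_baseChange_quotient_eq_of_smul_le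
    (FractionRing ↥(padicCoeffIntegers S)) hle c
    (IsLocalization.map_units (FractionRing ↥(padicCoeffIntegers S)) ⟨c, mem_nonZeroDivisors_of_ne_zero hc⟩) ?_
  intro x hx
  rw [Ideal.mem_span_singleton'] at hx
  obtain ⟨b, rfl⟩ := hx
  rw [PowerSeries.smul_eq_C_mul, ← mul_assoc, mul_comm (PowerSeries.C c) b, mul_assoc]
  exact Ideal.mul_mem_left _ b (Ideal.mem_span_singleton_self _)

/-- **(M)-falsifier, multiplier side, IN KERNEL:** a UNIT twist `μ̃ ↦ h·μ̃` (`h ∈ Λ_𝒪ˣ`, e.g. `h = 1 + X`) is `λ`-invisible —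
the ideals `(h·μ̃) = (μ̃)` coincide (`Ideal.span_singleton_mul_left_unit`). -/
theorem lamO_quot_span_unit_mul_eq (h μ : IwasawaAlgebraO S) (hh : IsUnit h) :
    lamO S (IwasawaAlgebraO S ⧸ Ideal.span {h * μ}) = lamO S (IwasawaAlgebraO S ⧸ Ideal.span {μ}) := by
  rw [Ideal.span_singleton_mul_left_unit hh]

/-- **(M)-falsifier, zeta side, IN KERNEL:** a UNIT twist `z ↦ h • z` (`h ∈ Λ_𝒪ˣ`) does not change the zeta quotient's `λ` —
`Λ_𝒪·(h • z) = Λ_𝒪·z` (`Submodule.span_singleton_smul_eq`). So on the pair `(z, (1+X)•z)` both sides of the slack are unchanged: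
the (G2) unit sub-case is slack-neutral with NO appeal to H-STAB. -/
theorem lamO_zetaQuot_unit_smul_eq [Module ↥(padicCoeffIntegers S) I.H]
    [IsScalarTower ↥(padicCoeffIntegers S) (IwasawaAlgebraO S) I.H] (h : IwasawaAlgebraO S) (hh : IsUnit h) (z : I.H) :
    lamO S (zetaQuot I (h • z)) = lamO S (zetaQuot I z) := by
  show lamO S (I.H ⧸ Submodule.span (IwasawaAlgebraO S) ({h • z} : Set I.H)) =
    lamO S (I.H ⧸ Submodule.span (IwasawaAlgebraO S) ({z} : Set I.H))
  rw [Submodule.span_singleton_smul_eq hh z]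

/-- **(B≡) the census closure = slack invariance across valued classes at one frame — TYPED SIGNATURE (nothing asserted; this is
k1-g31's station, Q175, typed here only to make the census self-contained).** Any two valued classes `(z, c′, w, q, μ̃)`,
`(z′, c″, w′, q′, μ̃′)` at the same pins and frame have equal slack: `λ(𝐇¹/Λz) + λ(Λ/μ̃′) = λ(𝐇¹/Λz′) + λ(Λ/μ̃)`.  By the census it is
implied by rank one (Kato 12.4 (2)) + the class rigidity (BKρ pins the even-character sums; VALρ + Rohrlich + the identity principle
pin `q·μ̃` up to `Frac 𝒪`). -/
def SlackInvarianceStatement [W.IsGloballyMinimal] [Module ↥(padicCoeffIntegers S) I.H]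
    [IsScalarTower ↥(padicCoeffIntegers S) (IwasawaAlgebraO S) I.H] {M : ℕ} [NeZero M] (g : CuspForm (CongruenceSubgroup.Gamma0 M) 2)
    (ι : ModularForms.coeffField g →+* PadicAlgCl 2) (Ω : ℂ) : Prop :=
  ∀ (Φ : AlgebraicClosure ℚ_[2] ≃ₐ[ℚ] AlgebraicClosure (π.v.adicCompletion ℚ))
    (τ : ∀ m : ℕ, ZMod (2 ^ m) → Field.absoluteGaloisGroup ℚ_[2])
    (z z' : I.H) (c' c'' : Fin n → ↥(padicCoeffIntegers S)) (w w' : ℕ → Fin π.nb → PadicAlgCl 2) (q q' : PadicAlgCl 2)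
    (μt μt' : IwasawaAlgebraO S),
    π.KatoValuedClass g ι Ω Φ τ z c' w q μt → π.KatoValuedClass g ι Ω Φ τ z' c'' w' q' μt' →
    lamO S (zetaQuot I z) + lamO S (IwasawaAlgebraO S ⧸ Ideal.span {μt'}) =
      lamO S (zetaQuot I z') + lamO S (IwasawaAlgebraO S ⧸ Ideal.span {μt})

/-- The non-vacuity guards of a valued class, read off (trivial projections; used by the census to exclude `q = 0` / `μ̃ = 0` words). -/
theorem q_ne_zero_and_mut_ne_zero_of_katoValuedClass [W.IsGloballyMinimal] {M : ℕ} [NeZero M]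
    (g : CuspForm (CongruenceSubgroup.Gamma0 M) 2) (ι : ModularForms.coeffField g →+* PadicAlgCl 2) (Ω : ℂ)
    (Φ : AlgebraicClosure ℚ_[2] ≃ₐ[ℚ] AlgebraicClosure (π.v.adicCompletion ℚ))
    (τ : ∀ m : ℕ, ZMod (2 ^ m) → Field.absoluteGaloisGroup ℚ_[2])
    (z : I.H) (c' : Fin n → ↥(padicCoeffIntegers S)) (w : ℕ → Fin π.nb → PadicAlgCl 2) (q : PadicAlgCl 2) (μt : IwasawaAlgebraO S)
    (h : π.KatoValuedClass g ι Ω Φ τ z c' w q μt) : q ≠ 0 ∧ μt ≠ 0 ∧ π.CoordNondeg c' :=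
  ⟨h.1, h.2.1, h.2.2.1⟩

/-- **(G5₀) at class level:** the (ND) conjunct of a valued class survives the coordinate gauge (from `coordNondeg_mul_left`). -/
theorem coordNondeg_gauge_of_katoValuedClass [W.IsGloballyMinimal] {M : ℕ} [NeZero M]
    (g : CuspForm (CongruenceSubgroup.Gamma0 M) 2) (ι : ModularForms.coeffField g →+* PadicAlgCl 2) (Ω : ℂ)
    (Φ : AlgebraicClosure ℚ_[2] ≃ₐ[ℚ] AlgebraicClosure (π.v.adicCompletion ℚ))
    (τ : ∀ m : ℕ, ZMod (2 ^ m) → Field.absoluteGaloisGroup ℚ_[2])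
    (z : I.H) (c' : Fin n → ↥(padicCoeffIntegers S)) (w : ℕ → Fin π.nb → PadicAlgCl 2) (q : PadicAlgCl 2) (μt : IwasawaAlgebraO S)
    (h : π.KatoValuedClass g ι Ω Φ τ z c' w q μt) {u : ↥(padicCoeffIntegers S)} (hu : u ≠ 0) :
    π.CoordNondeg (fun i => u * c' i) :=
  coordNondeg_mul_left π h.2.2.1 hu

end Gauge

end Summit.BirchSwinnertonDyer.BirchSwinnertonDyer.Cruxes.ResidualThetaCountLowerPureAtTwo.SideaK4G31

end
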